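import Mathlib
import Literature.AlgebraicGeometry.Resolution.CobordantGame
import Literature.AlgebraicGeometry.Resolution.CobordantChartCoefficients
import Literature.AlgebraicGeometry.Resolution.CobordantChartPlaneSlice
import Literature.AlgebraicGeometry.Resolution.CobordantTupleGame
import Literature.AlgebraicGeometry.Resolution.FormalCoordinateChange
import Summits.ResolutionOfSingularities.ResolutionOfSingularities.Theorems.WeightedInvariantLocalWeightedDropMonicLinearBlowupDoublePoint
import Summits.ResolutionOfSingularities.ResolutionOfSingularities.Theorems.WeightedInvariantLocalWeightedDropMonicDoublePointLift

/-!
# `WeightedInvariant.LocalWeightedDrop`: linear-centre blow-ups of a SEPARABLE char-2 double point `y² + A₁ y + A₀` with RE-CENTRING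

Crux item stmt-ResolutionOfSingularities-8899 `LocalWeightedDrop`, skeleton v31, residual stubs W4|₄ / W4|₅₊ (`d = 2` slice: char-2 monic double
points, separable = Artin–Schreier when `A₁ ≠ 0`).  [OURS · L1 W4.3, chain w43, stub worker 4 (gen 4): the Artin–Schreier twin of
`won_dp_of_linearBlowup_charTwo` (which is the case `A₁ = 0`); the move-brick of the SEPARABLE reduction game in every dimension; NOT a statement
of any manuscript.]

`won_dp1_of_linearBlowup_charTwo` (characteristic `2`, every dimension, every weight vector `w` on the old slots with odd positive entries): if
`A₀ ∘ chart_w(c) = s² · B₀` and `A₁ ∘ chart_w(c) = s · B₁` at every exceptional point of the old slots (NO condition on `B_j(0)`), then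
`y² + A₁ y + A₀` is won as soon as for every such `c`, every live old slot `i₀`, all data `B₀, B₁` and every `γ` the RE-CENTRED singular slice
`y² + B₁| · y + (γ² + γ B₁| + B₀|)` (`B| = B|_{x'_{i₀} = 0}`) is won: in characteristic `2`, `(γ + Y)² + B₁(γ + Y) + B₀ = Y² + B₁ Y + (γ² + γB₁ + B₀)`.
Over `c' = 0` nothing is singular (`B_j(0) = 0`, `γ ≠ 0`, constant term `γ²`).
-/

set_option linter.dupNamespace false -- mandated namespace of this single-conjunct summit

namespace Summit.ResolutionOfSingularities.ResolutionOfSingularities.Theorems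

open Literature.AlgebraicGeometry.Resolution
open Literature.AlgebraicGeometry.Resolution.CobordantGame

namespace MonicLinearBlowup

open MvPowerSeries TerminalDoublePointDim

variable {k : Type} [Field k] {m : ℕ}

/-- The factorisation datum `B` (`A ∘ chart_w(0) = s^n · B`, `n ≠ 0`) vanishes at the origin when the old-slot point is `0`. -/
theorem constantCoeff_factor_eq_zero_of_pt_zero' {n : ℕ} (w : Fin n → ℕ) (A : MvPowerSeries (Fin n) k) {e : ℕ} (he : e ≠ 0)
    {B : MvPowerSeries (Fin (n + 1)) k} (hB : subst (CobordantChart.chart w (0 : Fin n → k)) A = X 0 ^ e * B) :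
    constantCoeff B = 0 := by
  have h := CobordantChart.coeff_cons_zero_subst_chart w (0 : Fin n → k) (fun _ _ => rfl) A e
  rw [initEval_zero_pt w he] at h
  rw [← coeff_zero_eq_constantCoeff_apply, ← Finsupp.cons_zero_zero, CobordantChart.coeff_cons_of_eq_X_pow_mul hB 0 0, add_zero]
  exact h

/-- The slice `x'_{i₀} ↦ 0` of `(γ + Y)² + B₁♮ (γ + Y) + B₀♮`. -/
theorem slice_g₀_dp1 (i₀ : Fin (m + 1)) (γ : k) (B₀ B₁ : MvPowerSeries (Fin (m + 1 + 1)) k) :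
    subst (fun j : Fin (m + 1 + 1 + 1) => if j = (Fin.castSucc i₀).succ then (0 : MvPowerSeries (Fin (m + 1 + 1)) k)
        else X (Fin.predAbove (Fin.castSucc i₀) j))
      ((C γ + X (Fin.last (m + 1 + 1))) ^ 2 + rename (Fin.succAboveEmb (Fin.last (m + 1 + 1))) B₀ +
        rename (Fin.succAboveEmb (Fin.last (m + 1 + 1))) B₁ * (C γ + X (Fin.last (m + 1 + 1)))) =
      (C γ + X (Fin.last (m + 1))) ^ 2 + rename (Fin.succAboveEmb (Fin.last (m + 1))) (TupleGame.slice i₀ B₀) +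
        rename (Fin.succAboveEmb (Fin.last (m + 1))) (TupleGame.slice i₀ B₁) * (C γ + X (Fin.last (m + 1))) := by
  have hs := CobordantChartPlaneSlice.hasSubst_slice (R := k) (Fin.castSucc i₀)
  rw [← coe_substAlgHom hs]
  simp only [map_add, map_mul, map_pow, coe_substAlgHom, subst_C, MultiplicityLift.slice_X_last, MultiplicityLift.slice_rename]

end MonicLinearBlowup

open MonicLinearBlowup MvPowerSeries TerminalDoublePointDim in
/-- **LINEAR-CENTRE BLOW-UP OF A SEPARABLE CHARACTERISTIC-2 DOUBLE POINT WITH RE-CENTRING** (every dimension, every weight vector `w` on the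
old slots with odd positive entries; see the module docstring). [OURS · L1 W4.3] -/
theorem won_dp1_of_linearBlowup_charTwo (k : Type) [Field k] [CharP k 2] {m : ℕ}
    (w : Fin (m + 1) → ℕ) (hw : ∀ l, 0 < w l → ¬ 2 ∣ w l) (A₀ A₁ : MvPowerSeries (Fin (m + 1)) k)
    (hperm : ∀ c : Fin (m + 1) → k, (∀ l, w l = 0 → c l = 0) → ∃ B₀ B₁ : MvPowerSeries (Fin (m + 1 + 1)) k,
      MvPowerSeries.subst (CobordantChart.chart w c) A₀ = MvPowerSeries.X 0 ^ 2 * B₀ ∧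
      MvPowerSeries.subst (CobordantChart.chart w c) A₁ = MvPowerSeries.X 0 ^ 1 * B₁)
    (hsucc : ∀ c : Fin (m + 1) → k, (∀ l, w l = 0 → c l = 0) → ∀ i₀ : Fin (m + 1), c i₀ ≠ 0 →
      ∀ B₀ B₁ : MvPowerSeries (Fin (m + 1 + 1)) k,
      MvPowerSeries.subst (CobordantChart.chart w c) A₀ = MvPowerSeries.X 0 ^ 2 * B₀ →
      MvPowerSeries.subst (CobordantChart.chart w c) A₁ = MvPowerSeries.X 0 ^ 1 * B₁ →
      ∀ γ : k, CobordantGame.IsSingular k (MvPowerSeries.X (Fin.last (m + 1)) ^ 2 +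
        (MvPowerSeries.rename (Fin.succAboveEmb (Fin.last (m + 1)))
            (MvPowerSeries.C (γ ^ 2) + MvPowerSeries.C γ * TupleGame.slice i₀ B₁ + TupleGame.slice i₀ B₀) +
          MvPowerSeries.rename (Fin.succAboveEmb (Fin.last (m + 1))) (TupleGame.slice i₀ B₁) * MvPowerSeries.X (Fin.last (m + 1)))) →
      CobordantGame.Won k (m + 1 + 1) (MvPowerSeries.X (Fin.last (m + 1)) ^ 2 +
        (MvPowerSeries.rename (Fin.succAboveEmb (Fin.last (m + 1)))
            (MvPowerSeries.C (γ ^ 2) + MvPowerSeries.C γ * TupleGame.slice i₀ B₁ + TupleGame.slice i₀ B₀) +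
          MvPowerSeries.rename (Fin.succAboveEmb (Fin.last (m + 1))) (TupleGame.slice i₀ B₁) * MvPowerSeries.X (Fin.last (m + 1))))) :
    CobordantGame.Won k (m + 1 + 1) (MvPowerSeries.X (Fin.last (m + 1)) ^ 2 +
      (MvPowerSeries.rename (Fin.succAboveEmb (Fin.last (m + 1))) A₀ +
        MvPowerSeries.rename (Fin.succAboveEmb (Fin.last (m + 1))) A₁ * MvPowerSeries.X (Fin.last (m + 1)))) := by
  classical
  set Wt : Fin (m + 1 + 1) → ℕ := Fin.insertNth (α := fun _ => ℕ) (Fin.last (m + 1)) 1 w with hWtdef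
  set P : MvPowerSeries (Fin (m + 1 + 1)) k := X (Fin.last (m + 1)) ^ 2 +
    (rename (Fin.succAboveEmb (Fin.last (m + 1))) A₀ + rename (Fin.succAboveEmb (Fin.last (m + 1))) A₁ * X (Fin.last (m + 1))) with hP
  have hWtlast : Wt (Fin.last (m + 1)) = 1 := by rw [hWtdef, Fin.insertNth_apply_same]
  have hWtcast : ∀ l, Wt (Fin.castSucc l) = w l := fun l => by rw [hWtdef, insertNth_castSucc]
  have hmove : IsMove k (X : Fin (m + 1 + 1) → MvPowerSeries (Fin (m + 1 + 1)) k) Wt := by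
    refine ⟨fun l => constantCoeff_X l, ?_, ⟨Fin.last (m + 1), by rw [hWtlast]; exact one_pos⟩⟩
    rw [← FormalCoordChange.linSubst_one, ConeDichotomy.linMat_linSubst, Matrix.det_one]
    exact isUnit_one
  refine Won.move X Wt hmove fun g hg => ?_
  obtain ⟨pt, a, ⟨l, hWl, hptl⟩, hfac, hndvd, hsing⟩ := hg
  have hself : subst (X : Fin (m + 1 + 1) → MvPowerSeries (Fin (m + 1 + 1)) k) P = P := by
    rw [subst_self]; rfl
  rw [hself] at hfac
  set c : Fin (m + 1) → k := fun l => if 0 < w l then pt (Fin.castSucc l) else 0 with hc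
  have hc0 : ∀ l, w l = 0 → c l = 0 := fun l hl => by
    rw [hc]; dsimp only; rw [hl, if_neg (lt_irrefl 0)]
  obtain ⟨B₀, B₁, hB₀, hB₁⟩ := hperm c hc0
  have hch := CobordantChart.hasSubst_chart w c hc0
  set B : Fin 2 → MvPowerSeries (Fin (m + 1 + 1)) k := ![B₀, B₁] with hB
  have hBfac : ∀ j : Fin 2, subst (CobordantChart.chart w c) ((![A₀, A₁] : Fin 2 → MvPowerSeries (Fin (m + 1)) k) j) =
      X 0 ^ (2 - (j : ℕ)) * B j := by
    intro j
    fin_cases j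
    · simpa [hB] using hB₀
    · simpa [hB] using hB₁
  set γ : k := pt (Fin.last (m + 1)) with hγ
  set g₀ : MvPowerSeries (Fin (m + 1 + 1 + 1)) k := (C γ + X (Fin.last (m + 1 + 1))) ^ 2 +
    ∑ j : Fin 2, rename (Fin.succAboveEmb (Fin.last (m + 1 + 1))) (B j) * (C γ + X (Fin.last (m + 1 + 1))) ^ (j : ℕ) with hg₀
  have hT : subst (cruxChart k Wt pt) P = X 0 ^ 2 * g₀ := by
    rw [hP, MonicDoublePointLift.monic_two_eq_sum, hWtdef, transform_linear w _ pt B hBfac]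
  have hndvd₀ : ¬ X 0 ∣ g₀ := not_X_dvd_g₀ γ B
  have hfac₀ := hfac
  rw [hT] at hfac
  obtain ⟨-, hgg⟩ := X_pow_mul_eq_X_pow_mul 0 hfac hndvd₀ hndvd
  subst hgg
  have hg₀' : g₀ = (C γ + X (Fin.last (m + 1 + 1))) ^ 2 + rename (Fin.succAboveEmb (Fin.last (m + 1 + 1))) B₀ +
      rename (Fin.succAboveEmb (Fin.last (m + 1 + 1))) B₁ * (C γ + X (Fin.last (m + 1 + 1))) := by
    rw [hg₀, Fin.sum_univ_two]
    simp only [hB, Matrix.cons_val_zero, Matrix.cons_val_one, Fin.val_zero, Fin.val_one, pow_zero, mul_one, pow_one]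
    ring
  -- a live OLD slot: otherwise `c = 0`, `B_j(0) = 0`, `γ ≠ 0` and `g₀(0) = γ² ≠ 0`
  have hlive : ∃ i₀ : Fin (m + 1), c i₀ ≠ 0 := by
    by_contra hnone
    push Not at hnone
    have hc00 : c = 0 := funext hnone
    have hB00 : constantCoeff B₀ = 0 := constantCoeff_factor_eq_zero_of_pt_zero' w A₀ two_ne_zero (by rw [← hc00]; exact hB₀)
    have hB10 : constantCoeff B₁ = 0 := constantCoeff_factor_eq_zero_of_pt_zero' w A₁ one_ne_zero (by rw [← hc00]; exact hB₁)
    have hγ0 : γ ≠ 0 := by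
      rcases Fin.eq_castSucc_or_eq_last l with ⟨i, rfl⟩ | h
      · exfalso
        have hwi : 0 < w i := by rwa [hWtcast] at hWl
        have := hnone i
        rw [hc] at this
        dsimp only at this
        rw [if_pos hwi] at this
        exact hptl this
      · rw [hγ, ← h]; exact hptl
    have h00 := hsing.1
    rw [hg₀', map_add, map_add, constantCoeff_C_add_X_sq, constantCoeff_rename, hB00, add_zero, map_mul, constantCoeff_rename, hB10,
      zero_mul, add_zero] at h00
    exact hγ0 (pow_eq_zero_iff two_ne_zero |>.mp h00)
  obtain ⟨i₀, hci₀⟩ := hlive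
  have hwi₀ : 0 < w i₀ := by
    by_contra h
    exact hci₀ (hc0 i₀ (by omega))
  -- the tame slice at `x'_{i₀}`
  obtain ⟨Cb, hCb⟩ : ∃ Cb : Fin (m + 1 + 1) → k, ∀ l, Cb l = if 0 < Wt l then pt l else 0 := ⟨_, fun _ => rfl⟩
  have hconvb : ∀ l, Wt l = 0 → Cb l = 0 := fun l hl => by rw [hCb, hl, if_neg (lt_irrefl 0)]
  have hccb : cruxChart k Wt pt = CobordantChart.chart Wt Cb := by
    rw [show Cb = fun l => if 0 < Wt l then pt l else 0 from funext hCb]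
    exact CobordantChart.cruxChart_eq_chart Wt pt
  have hCbi : Cb (Fin.castSucc i₀) ≠ 0 := by
    rw [hCb, hWtcast, if_pos hwi₀]
    have := hci₀
    rw [hc] at this
    dsimp only at this
    rwa [if_pos hwi₀] at this
  rw [hccb] at hfac₀
  obtain ⟨Φ, u, hΦ0, hΦdet, hu, hgeq⟩ := tameSlice 2 Nat.prime_two k (m + 1 + 1) P Wt Cb hconvb a g₀ hfac₀ (Fin.castSucc i₀) hCbi
    (by rw [hWtcast]; exact hw i₀ hwi₀)
  -- characteristic `2`: re-centre
  have hsq : ((C γ + X (Fin.last (m + 1))) ^ 2 : MvPowerSeries (Fin (m + 1 + 1)) k) +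
      rename (Fin.succAboveEmb (Fin.last (m + 1))) (TupleGame.slice i₀ B₀) +
      rename (Fin.succAboveEmb (Fin.last (m + 1))) (TupleGame.slice i₀ B₁) * (C γ + X (Fin.last (m + 1))) =
      X (Fin.last (m + 1)) ^ 2 +
        (rename (Fin.succAboveEmb (Fin.last (m + 1))) (C (γ ^ 2) + C γ * TupleGame.slice i₀ B₁ + TupleGame.slice i₀ B₀) +
          rename (Fin.succAboveEmb (Fin.last (m + 1))) (TupleGame.slice i₀ B₁) * X (Fin.last (m + 1))) := by
    haveI : CharP (MvPowerSeries (Fin (m + 1 + 1)) k) 2 :=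
      charP_of_injective_algebraMap (C_injective (σ := Fin (m + 1 + 1)) (R := k)) 2
    rw [add_pow_two, show (2 : MvPowerSeries (Fin (m + 1 + 1)) k) = 0 from CharTwo.two_eq_zero, zero_mul, zero_mul, add_zero,
      map_add, map_add, map_mul, rename_C, rename_C, map_pow]
    ring
  conv at hgeq => rhs; rw [hg₀', slice_g₀_dp1 i₀ γ B₀ B₁, hsq]
  rw [hgeq]
  refine (won_unit_mul_iff hu _).mpr ((won_subst_iff hΦ0 hΦdet _).mpr (won_cyl (Fin.castSucc i₀).succ ?_))
  by_cases hSs : IsSingular k (X (Fin.last (m + 1)) ^ 2 +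
      (rename (Fin.succAboveEmb (Fin.last (m + 1))) (C (γ ^ 2) + C γ * TupleGame.slice i₀ B₁ + TupleGame.slice i₀ B₀) +
        rename (Fin.succAboveEmb (Fin.last (m + 1))) (TupleGame.slice i₀ B₁) * X (Fin.last (m + 1))))
  · exact hsucc c hc0 i₀ hci₀ B₀ B₁ hB₀ hB₁ γ hSs
  · exact (wonBy_zero_of_not_isSingular (Nat.succ_pos _) hSs).won

end Summit.ResolutionOfSingularities.ResolutionOfSingularities.Theorems
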